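import Literature.NumberTheory.Transcendental.BrownLevelMatrices
import Literature.NumberTheory.Transcendental.BrownHoffmanModel
import HarnessLib

/-!
# Brown, *Mixed Tate motives over ℤ* (2012) — Theorem 7.4 (linear independence of the Hoffman
# elements) from the level-lowering operators, and the named fact from Brown's motivic data

Sibling file in the cone of the named fact
`Literature.NumberTheory.Transcendental.hoffmanSpan_eq_mzvSpace` (Brown 2012, Theorem 1.1). This
file formalizes §7.2 of Brown's paper — the induction on the level proving **Theorem 7.4** — on
top of Theorem 7.3 for all levels (`Brown2012.isUnit_levelMatrix_add`, file `BrownLevelMatrices`),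
ABSTRACTLY: over any `ℚ`-vector space `H` carrying vectors `z(w)` (Brown's `ζᵐ(w)`) and linear
operators `D r` (Brown's `ζ_{2r+1}`-components of `D_{2r+1}`, Definition 5.7 with (5.5)) subject to
the two motivic facts that Brown proves about them and that cannot be formalized here:

* (level lowering — Lemma 5.5, and Lemma 3.4 for level `0`) `D r` maps the span of the `z(w)`,
  `|w| = N`, `deg₃ w ≤ ℓ`, into the span of the `z(u)`, `|u| = N - 2r - 1`, `deg₃ u ≤ ℓ - 1`
  (and kills level `0`);
* (the matrix — Theorem 6.1 with (5.7), Theorem 4.3, Corollary 4.4 (1), Lemma 3.8) on a word of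
  level `ℓ ≥ 1`, `w = u' 3 2^{r'-1}`, `D r (z w) ≡ ∑_u (T_{N,ℓ} + E)_{u',u} z(u)` modulo level
  `< ℓ - 1`, the sum over the `u ∈ B'_{N,ℓ}` of weight `N - 2r - 1`, for some matrix `E` with
  entries in `2ℤ₍₂₎` (`μ(I) ⊆ 2ℤ`), `T_{N,ℓ}` the deconcatenation matrix (`Brown2012.levelMatrix`);

together with `z(2ⁿ) ≠ 0` (Lemma 3.4). These are the fields of `Brown2012.LevelData`. We PROVE:

* `Brown2012.linearIndependent_levelLT` — **Theorem 7.4**: for such data the `z(w)`,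
  `w ∈ {2,3}^×`, are linearly independent (by induction on the level: a relation in level `ℓ`
  is mapped by `⊕_r D r` to a relation of lower level with coefficient vector `λ (T + E)`, and
  `T + E` is invertible by Theorem 7.3; "no relations between different levels" is built into the
  inductive statement `deg₃ < ℓ`);
* `Brown2012.MotivicData`, `hoffmanSpan_eq_mzvSpace_of_motivicData` — adding the remaining inputs
  of §§2, 7.2 (finite-dimensional weight pieces `V_N ⊆ H` of dimension `≤ d_N` containing the lifts
  of all admissible indices of weight `N` — (2.23), Deligne–Goncharov — and the period map with
  `per (z s.reverse) = multipleZeta s`, (2.11)–(2.13), (2.19): the level data are written in Brown's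
  order of the arguments, the tree's `multipleZeta` in the reverse order, see the CONVENTIONS
  paragraph of `Brown2012.MotivicData`) yields a `HoffmanModel` in every weight
  (`Brown2012.MotivicData.hoffmanModel`) and hence **the named fact `hoffmanSpan_eq_mzvSpace`**.

Thus the fact is formally reduced to Brown's motivic data: the existence of `(H, z, D, V, per)` as
above, i.e. to the theory of mixed Tate motives over `ℤ` and motivic multiple zeta values
(Theorems 2.x, 3.3, 4.3, Lemma 5.5, Theorem 6.1 of the paper), which Mathlib does not have.
No named facts are introduced (the structures are hypothesis bundles, D-0026).

## References

* F. Brown, *Mixed Tate motives over ℤ*, Ann. of Math. **175** (2012), 949–976: Lemma 3.4,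
  Lemma 5.5, Definition 5.7, (5.7), Theorem 6.1, Theorems 7.3, 7.4, (7.2), Corollary 7.5
  (arXiv:1102.1312). [Brown2012]
-/

noncomputable section

open scoped BigOperators

namespace Literature.NumberTheory.Transcendental

namespace Brown2012

open MZV

/-! ### Words of weight `N` and level `< ℓ`; the strict level filtration -/

/-- Hoffman words of weight `N` and level `< ℓ` (the basis of Brown's `F_{ℓ-1} H^{2,3}_N`).
[cite: Brown2012, Definition 5.4] -/
abbrev LWordLT (N ℓ : ℕ) : Type := {w : List ℕ // IsHoffman w ∧ weight w = N ∧ level w < ℓ}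

/-- Finiteness of the words of weight `N` and level `< ℓ`. [folklore] -/
instance finite_lWordLT (N ℓ : ℕ) : Finite (LWordLT N ℓ) := by
  haveI := finite_hoffman N
  exact Finite.of_injective (fun w : LWordLT N ℓ =>
    (⟨w.1, w.2.1, w.2.2.1⟩ : {s : List ℕ // IsHoffman s ∧ weight s = N}))
    fun a b h => Subtype.ext (by simpa using congrArg Subtype.val h)

/-- As a finite type. [folklore] -/
noncomputable instance fintype_lWordLT (N ℓ : ℕ) : Fintype (LWordLT N ℓ) := Fintype.ofFinite _

/-- No word has level `< 0`. [folklore] -/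
instance isEmpty_lWordLT_zero (N : ℕ) : IsEmpty (LWordLT N 0) :=
  ⟨fun w => absurd w.2.2.2 (Nat.not_lt_zero _)⟩

/-- There is at most one word of level `0` in each weight (`2^{N/2}`). [folklore] -/
instance subsingleton_lWordLT_one (N : ℕ) : Subsingleton (LWordLT N 1) := by
  refine ⟨fun a b => Subtype.ext ?_⟩
  have ha := eq_replicate_two_of_level_eq_zero a.2.1 (by have := a.2.2.2; omega)
  have hb := eq_replicate_two_of_level_eq_zero b.2.1 (by have := b.2.2.2; omega)
  have hwa := a.2.2.1
  have hwb := b.2.2.1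
  rw [ha] at hwa
  rw [hb] at hwb
  simp only [weight, List.sum_replicate, smul_eq_mul] at hwa hwb
  rw [ha, hb, show a.1.length = b.1.length by omega]

/-- A Hoffman word is no longer than its weight. [folklore] -/
theorem length_le_weight : ∀ {w : List ℕ}, IsHoffman w → w.length ≤ weight w
  | [], _ => by simp
  | a :: w, hw => by
      have ha : 1 ≤ a := by rcases hw a (by simp) with rfl | rfl <;> norm_num
      have ih := length_le_weight (w := w) fun i hi => hw i (by simp [hi])
      rw [weight_cons, List.length_cons]
      omega

/-- The level of a Hoffman word is at most its weight. [folklore] -/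
theorem level_lt_weight_succ {w : List ℕ} (hw : IsHoffman w) : level w < weight w + 1 := by
  have h1 : level w ≤ w.length := List.count_le_length
  have h2 := length_le_weight hw
  omega

variable {H : Type} [AddCommGroup H] [Module ℚ H]

/-- The span `G_{N,ℓ}` of the `z(w)` over the words of weight `N` and level `< ℓ` — Brown's
`F_{ℓ-1} H^{2,3}_N` (Definition 5.4; `G_{N,0} = 0`). [cite: Brown2012, Definition 5.4] -/
def levelSpan (z : List ℕ → H) (N ℓ : ℕ) : Submodule ℚ H :=
  Submodule.span ℚ (Set.range fun w : LWordLT N ℓ => z w.1)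

/-! ### Brown's level data and Theorem 7.4 -/

/-- **Brown's level-lowering data, abstractly**: a `ℚ`-vector space `H` (Brown's `H`), vectors
`z w` (the motivic `ζᵐ(w)`, `w ∈ {2,3}^×`; `z` is a function on all indices), linear operators
`D r` (the `ζ_{2r+1}`-component of `D_{2r+1}`, Definition 5.7 / (5.5)), and the motivic facts:
`level_lowering` (Lemma 5.5, and Lemma 3.4: `D_{2r+1} ζᵐ(2ⁿ) = 0`), `matrix_eq` (Theorem 6.1 with
(5.7): on `w = u' 3 2^{r'-1} ∈ B_{N,ℓ}`, `D r (z w) ≡ ∑_{u ∈ B'_{N,ℓ}, |u| = N-2r-1} (T_{N,ℓ} + E)_{u',u} z(u)`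
modulo level `< ℓ - 1`, where `E = μ(M^f_{N,ℓ} - T^f_{N,ℓ})` has entries in `μ(I) ⊆ 2ℤ` by
Corollary 4.4 (1) and Lemma 3.8 — here: entries `0` or of `2`-adic valuation `≥ 1`), and
`z_replicate_two_ne_zero` (Lemma 3.4: `ζᵐ(2ⁿ) ≠ 0`).
[cite: Brown2012, Lemma 5.5, Theorem 6.1 and §7.2] -/
structure LevelData where
  /-- Brown's space `H` of motivic multiple zeta values. -/
  H : Type
  [instAddCommGroup : AddCommGroup H]
  [instModule : Module ℚ H]
  /-- The motivic lifts `ζᵐ(s)`. -/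
  z : List ℕ → H
  /-- The `ζ_{2r+1}`-components of the derivations `D_{2r+1}`. -/
  D : ℕ → H →ₗ[ℚ] H
  /-- Lemma 5.5 (and Lemma 3.4 in level `0`): `D r` lowers the level. -/
  level_lowering : ∀ r N ℓ : ℕ,
    (levelSpan z N (ℓ + 1)).map (D r) ≤ levelSpan z (N - (2 * r + 1)) ℓ
  /-- The correction `μ(M^f_{N,ℓ}) - T_{N,ℓ}`. -/
  E : (N ℓ : ℕ) → Matrix (ColWord N ℓ)ᵒᵈ (ColWord N ℓ)ᵒᵈ ℚ
  /-- Its entries lie in `μ(I) ⊆ 2ℤ`: they are `0` or of `2`-adic valuation `≥ 1`. -/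
  E_small : ∀ N ℓ i j, E N ℓ i j = 0 ∨ 1 ≤ padicValRat 2 (E N ℓ i j)
  /-- Theorem 6.1 with (5.7): the matrix of `∂_{N,ℓ}` is `T_{N,ℓ} + E` modulo lower level. -/
  matrix_eq : ∀ (N ℓ : ℕ), 1 ≤ ℓ → ∀ (u' : ColWord N ℓ) (r : ℕ),
    D r (z (phi N u'.1)) -
      ∑ u ∈ Finset.univ.filter (fun u : ColWord N ℓ => weight u.1 + (2 * r + 1) = N),
        (levelMatrix N ℓ + E N ℓ) (OrderDual.toDual u') (OrderDual.toDual u) • z u.1 ∈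
      levelSpan z (N - (2 * r + 1)) (ℓ - 1)
  /-- Lemma 3.4: `ζᵐ(2ⁿ) ≠ 0`. -/
  z_replicate_two_ne_zero : ∀ n, z (List.replicate n 2) ≠ 0

attribute [instance] LevelData.instAddCommGroup LevelData.instModule

namespace LevelData

variable (L : LevelData)

/-- Level `< 0`: the empty family is independent. [folklore] -/
theorem linearIndependent_zero (N : ℕ) : LinearIndependent ℚ fun w : LWordLT N 0 => L.z w.1 :=
  linearIndependent_empty_type

/-- Level `< 1`: the single word `2ⁿ` of level `0`, with `z(2ⁿ) ≠ 0` (Lemma 3.4: "the elements of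
level zero … are linearly independent"). [cite: Brown2012, §7.2 proof of Theorem 7.4] -/
theorem linearIndependent_one (N : ℕ) : LinearIndependent ℚ fun w : LWordLT N 1 => L.z w.1 := by
  rw [Fintype.linearIndependent_iff]
  intro g hg i
  rw [Fintype.sum_subsingleton _ i] at hg
  have hz : L.z i.1 ≠ 0 := by
    rw [eq_replicate_two_of_level_eq_zero i.2.1 (by have := i.2.2.2; omega)]
    exact L.z_replicate_two_ne_zero _
  exact (smul_eq_zero.1 hg).resolve_right hz

/-- **The key step** (Brown 2012, §7.2): if a combination `∑ λ_{u'} z(u' 3 2^{r'-1})` of the level-`ℓ`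
elements of weight `N` lies in the span of the lower levels, and the lower levels are independent in
all weights, then `λ = 0`: applying `D r` gives `∑_u (λ(T+E))_u z(u) ≡ 0` modulo level `< ℓ - 1`
among independent vectors, so `λ (T+E)` vanishes column by column, and `T + E` is invertible
(Theorem 7.3). [cite: Brown2012, §7.2 proof of Theorem 7.4] -/
theorem eq_zero_of_sum_mem_levelSpan {ℓ : ℕ} (hℓ : 1 ≤ ℓ)
    (ih : ∀ N, LinearIndependent ℚ fun w : LWordLT N ℓ => L.z w.1) (N : ℕ)
    (c : ColWord N ℓ → ℚ)
    (hc : ∑ u', c u' • L.z (phi N u'.1) ∈ levelSpan L.z N ℓ) : c = 0 := by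
  classical
  set M := levelMatrix N ℓ + L.E N ℓ with hM
  -- the coefficient vector `λ (T + E)` vanishes
  have hvec : Matrix.vecMul (c ∘ OrderDual.ofDual) M = 0 := by
    funext j
    set u₀ : ColWord N ℓ := OrderDual.ofDual j with hu₀
    -- the `r` of the column `u₀`
    set r := twosAfter N u₀.1 + 1 with hr
    have hru : weight u₀.1 + (2 * r + 1) = N := by
      have h1 := u₀.2.2.2.1
      have h2 := u₀.2.2.2.2
      simp only [hr, twosAfter]
      omega
    set Nr := N - (2 * r + 1) with hNr
    -- apply `D r`: the image lies in level `< ℓ - 1`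
    have hD : L.D r (∑ u', c u' • L.z (phi N u'.1)) ∈ levelSpan L.z Nr (ℓ - 1) := by
      have h := L.level_lowering r N (ℓ - 1)
      rw [Nat.sub_add_cancel hℓ] at h
      exact h (Submodule.mem_map_of_mem hc)
    -- and it is `∑_{u'} c_{u'} (∑_{u : |u| = Nr} M_{u',u} z(u) + lower)`
    set S := Finset.univ.filter (fun u : ColWord N ℓ => weight u.1 + (2 * r + 1) = N) with hS
    have hsum : ∑ u ∈ S, (Matrix.vecMul (c ∘ OrderDual.ofDual) M) (OrderDual.toDual u) • L.z u.1 ∈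
        levelSpan L.z Nr (ℓ - 1) := by
      have h1 : ∑ u ∈ S, (Matrix.vecMul (c ∘ OrderDual.ofDual) M) (OrderDual.toDual u) • L.z u.1 =
          L.D r (∑ u', c u' • L.z (phi N u'.1)) -
            ∑ u', c u' • (L.D r (L.z (phi N u'.1)) -
              ∑ u ∈ S, M (OrderDual.toDual u') (OrderDual.toDual u) • L.z u.1) := by
        simp only [map_sum, map_smul, smul_sub, Finset.sum_sub_distrib, sub_sub_cancel,
          Finset.smul_sum, smul_smul]
        rw [Finset.sum_comm]
        refine Finset.sum_congr rfl fun u _ => ?_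
        rw [← Finset.sum_smul]
        congr 1
      rw [h1]
      refine Submodule.sub_mem _ hD (Submodule.sum_mem _ fun u' _ => Submodule.smul_mem _ _ ?_)
      exact L.matrix_eq N ℓ hℓ u' r
    -- embed the columns of weight `Nr` into the independent family of weight `Nr`, level `< ℓ`
    let e : {u // u ∈ S} → LWordLT Nr ℓ := fun u =>
      ⟨u.1.1, u.1.2.1, by have := (Finset.mem_filter.1 u.2).2; simp only [hNr]; omega,
        by have := u.1.2.2.1; omega⟩
    have he : Function.Injective e := by
      rintro ⟨⟨a, ha⟩, ha'⟩ ⟨⟨b, hb⟩, hb'⟩ h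
      simp only [e, Subtype.mk.injEq] at h
      exact Subtype.ext (Subtype.ext h)
    -- the sum lies in the span of the level-`(ℓ-1)` part and in the span of the level-`< ℓ-1` part
    have hx0 : ∑ u ∈ S, (Matrix.vecMul (c ∘ OrderDual.ofDual) M) (OrderDual.toDual u) • L.z u.1 = 0 := by
      have hdis := (ih Nr).disjoint_span_image
        (s := Set.range e) (t := {i : LWordLT Nr ℓ | level i.1 < ℓ - 1}) (by
          rw [Set.disjoint_left]
          rintro _ ⟨u, rfl⟩ hlt
          have := u.1.2.2.1
          simp only [Set.mem_setOf_eq, e] at hlt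
          omega)
      rw [Submodule.disjoint_def] at hdis
      refine hdis _ ?_ ?_
      · refine Submodule.sum_mem _ fun u hu => Submodule.smul_mem _ _ (Submodule.subset_span ?_)
        exact ⟨e ⟨u, hu⟩, ⟨⟨u, hu⟩, rfl⟩, rfl⟩
      · refine (Submodule.span_mono ?_) hsum
        rintro _ ⟨w, rfl⟩
        exact ⟨⟨w.1, w.2.1, w.2.2.1, by have := w.2.2.2; omega⟩, w.2.2.2, rfl⟩
    -- independence of the embedded columns: the coefficients vanish
    have hind : LinearIndependent ℚ ((fun w : LWordLT Nr ℓ => L.z w.1) ∘ e) := (ih Nr).comp e he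
    rw [Fintype.linearIndependent_iff] at hind
    have hu₀S : u₀ ∈ S := Finset.mem_filter.2 ⟨Finset.mem_univ _, hru⟩
    have h := hind (fun u => (Matrix.vecMul (c ∘ OrderDual.ofDual) M) (OrderDual.toDual u.1)) (by
      rw [← hx0, ← Finset.sum_attach S]
      rfl) ⟨u₀, hu₀S⟩
    simpa [hu₀] using h
  -- `T + E` is invertible (Theorem 7.3): `λ = 0`
  have hinj := (Matrix.vecMul_injective_iff_isUnit (A := M)).2
    (isUnit_levelMatrix_add N ℓ (L.E N ℓ) (L.E_small N ℓ))
  have h0 : (c ∘ OrderDual.ofDual) = 0 :=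
    hinj (show Matrix.vecMul (c ∘ OrderDual.ofDual) M = Matrix.vecMul 0 M by
      rw [hvec, Matrix.zero_vecMul])
  funext u
  have := congrFun h0 (OrderDual.toDual u)
  simpa using this

/-- The equivalence `(level < ℓ) ⊕ B'_{N,ℓ} ≃ (level < ℓ + 1)` in weight `N`, via (6.2) for the
level-`ℓ` words (`ℓ ≥ 1`). [cite: Brown2012, Corollary 6.2] -/
def sumEquiv (N : ℕ) {ℓ : ℕ} (hℓ : 1 ≤ ℓ) : LWordLT N ℓ ⊕ ColWord N ℓ ≃ LWordLT N (ℓ + 1) :=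
  Equiv.ofBijective
    (Sum.elim (fun w => ⟨w.1, w.2.1, w.2.2.1, Nat.lt_succ_of_lt w.2.2.2⟩)
      (fun u' => ⟨phi N u'.1, (phi_mem u').1, (phi_mem u').2.1,
        by rw [(phi_mem u').2.2]; exact Nat.lt_succ_self _⟩))
    (by
      constructor
      · rintro (a | a) (b | b) h
        · simp only [Sum.elim_inl, Subtype.mk.injEq] at h
          exact congrArg Sum.inl (Subtype.ext h)
        · exfalso
          simp only [Sum.elim_inl, Sum.elim_inr, Subtype.mk.injEq] at h
          have h1 := a.2.2.2
          rw [h, (phi_mem b).2.2] at h1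
          exact lt_irrefl _ h1
        · exfalso
          simp only [Sum.elim_inl, Sum.elim_inr, Subtype.mk.injEq] at h
          have h1 := b.2.2.2
          rw [← h, (phi_mem a).2.2] at h1
          exact lt_irrefl _ h1
        · simp only [Sum.elim_inr, Subtype.mk.injEq] at h
          have := (phiRow_bijective N ℓ hℓ).1 (Subtype.ext h : phiRow a = phiRow b)
          rw [this]
      · rintro ⟨w, hw, hwt, hwl⟩
        by_cases hlt : level w < ℓ
        · exact ⟨Sum.inl ⟨w, hw, hwt, hlt⟩, rfl⟩
        · have hle : level w = ℓ := by omega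
          obtain ⟨u', hu'⟩ := (phiRow_bijective N ℓ hℓ).2 ⟨w, hw, hwt, hle⟩
          refine ⟨Sum.inr u', Subtype.ext ?_⟩
          simp only [Sum.elim_inr]
          exact congrArg Subtype.val hu')

/-- **The induction step** (Brown 2012, §7.2): independence in levels `< ℓ` (all weights) implies
independence in levels `< ℓ + 1`. [cite: Brown2012, §7.2 proof of Theorem 7.4] -/
theorem linearIndependent_succ {ℓ : ℕ} (hℓ : 1 ≤ ℓ)
    (ih : ∀ N, LinearIndependent ℚ fun w : LWordLT N ℓ => L.z w.1) (N : ℕ) :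
    LinearIndependent ℚ fun w : LWordLT N (ℓ + 1) => L.z w.1 := by
  classical
  -- the level-`ℓ` family `u' ↦ z(u' 3 2^{r'-1})`
  have hkey := L.eq_zero_of_sum_mem_levelSpan hℓ ih N
  have hv' : LinearIndependent ℚ fun u' : ColWord N ℓ => L.z (phi N u'.1) := by
    rw [Fintype.linearIndependent_iff]
    intro g hg u'
    have := hkey g (by rw [hg]; exact Submodule.zero_mem _)
    exact congrFun this u'
  have hdis : Disjoint (Submodule.span ℚ (Set.range fun w : LWordLT N ℓ => L.z w.1))
      (Submodule.span ℚ (Set.range fun u' : ColWord N ℓ => L.z (phi N u'.1))) := by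
    rw [Submodule.disjoint_def]
    intro x hx hx'
    obtain ⟨g, rfl⟩ := (Submodule.mem_span_range_iff_exists_fun ℚ).1 hx'
    have := hkey g hx
    simp [this]
  have hsum := (ih N).sum_type hv' hdis
  refine (linearIndependent_equiv (sumEquiv N hℓ)).1 ?_
  have hfe : ((fun w : LWordLT N (ℓ + 1) => L.z w.1) ∘ (sumEquiv N hℓ)) =
      Sum.elim (fun w : LWordLT N ℓ => L.z w.1) (fun u' : ColWord N ℓ => L.z (phi N u'.1)) := by
    funext x
    rcases x with w | u' <;> rfl
  rw [hfe]
  exact hsum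

/-- **Brown 2012, Theorem 7.4, by induction on the level**: for level data, the `z(w)` over the
words of weight `N` and level `< ℓ` are linearly independent, for all `ℓ` and `N`.
[cite: Brown2012, Theorem 7.4] -/
theorem linearIndependent_levelLT (ℓ N : ℕ) : LinearIndependent ℚ fun w : LWordLT N ℓ => L.z w.1 := by
  induction ℓ generalizing N with
  | zero => exact L.linearIndependent_zero N
  | succ ℓ ih =>
    rcases Nat.eq_zero_or_pos ℓ with rfl | hℓ
    · exact L.linearIndependent_one N
    · exact L.linearIndependent_succ hℓ ih N

/-- **Brown 2012, Theorem 7.4**: for level data `(H, z, D)` the elements `z(w)`, `w ∈ {2,3}^×` of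
weight `N`, are linearly independent ("The elements `{ζᵐ(w) : w ∈ {2,3}^×}` are linearly
independent"). [cite: Brown2012, Theorem 7.4] -/
theorem linearIndependent_hoffman (N : ℕ) :
    LinearIndependent ℚ fun w : {w : List ℕ // IsHoffman w ∧ weight w = N} => L.z w.1 := by
  let e : {w : List ℕ // IsHoffman w ∧ weight w = N} ≃ LWordLT N (N + 1) :=
    Equiv.subtypeEquivRight fun w =>
      ⟨fun h => ⟨h.1, h.2, by rw [← h.2]; exact level_lt_weight_succ h.1⟩, fun h => ⟨h.1, h.2.1⟩⟩
  have h := L.linearIndependent_levelLT (N + 1) N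
  rw [← linearIndependent_equiv e] at h
  exact h

end LevelData

/-! ### Brown's motivic data and the named fact -/

/-- Reversal is an involution of the Hoffman words of weight `N`. [folklore] -/
def hoffmanReverseEquiv (N : ℕ) :
    {w : List ℕ // IsHoffman w ∧ weight w = N} ≃ {w : List ℕ // IsHoffman w ∧ weight w = N} where
  toFun w := ⟨w.1.reverse, fun i hi => w.2.1 i (List.mem_reverse.1 hi),
    by rw [weight, List.sum_reverse]; exact w.2.2⟩
  invFun w := ⟨w.1.reverse, fun i hi => w.2.1 i (List.mem_reverse.1 hi),
    by rw [weight, List.sum_reverse]; exact w.2.2⟩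
  left_inv w := Subtype.ext (List.reverse_reverse _)
  right_inv w := Subtype.ext (List.reverse_reverse _)

/-- **Brown's motivic data** (what the proof of Theorem 1.1 ⟹ Conjecture 2 uses of `MT(ℤ)` and of
motivic multiple zeta values): level data `(H, z, D)` as above, the period map `per : H → ℝ`
((2.11)), and finite-dimensional weight pieces `V_N ⊆ H` (Brown's `H_N ⊆ H_N^{MT⁺}`) containing the
`ζᵐ` of weight `N`, with `dim V_N ≤ d_N` ((2.23), Deligne–Goncharov).

CONVENTIONS. The level data are written in Brown's order: `z w` stands for Brown's
`ζᵐ(w) = Iᵐ(0; ρ(w); 1)` read left to right as in the paper (so that Theorem 6.1 deconcatenates a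
level-one SUFFIX `v` of `w = uv`, as in `levelMatrix`/`phi`), and Brown sums his multiple zeta values
over `0 < k₁ < ⋯ < k_r` (eq. (1.1)), whereas the tree's `multipleZeta [s₁,…,s_k]` sums over
`n₁ > ⋯ > n_k` (`MultipleZeta.lean`); hence Brown's `ζ(n₁,…,n_r) = multipleZeta [n_r,…,n₁]` and the
period of `z w` is `multipleZeta w.reverse` ((2.19): `per (ζᵐ(n₁,…,n_r)) = ζ(n₁,…,n_r)` for
`n_r ≥ 2`, i.e. for `w.reverse` admissible in the tree's sense). Accordingly `per_z` and `z_mem` are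
stated for `z s.reverse`, `s` admissible. (The first version of this structure had `per (z s)` here,
mixing the two conventions — Brown's data satisfy the present one.)
[cite: Brown2012, §2 (2.11)–(2.13), (2.19), (2.23) and §7.2] -/
structure MotivicData extends LevelData where
  /-- The period map (2.11). -/
  per : H →ₗ[ℚ] ℝ
  /-- (2.19): `per (ζᵐ(n₁,…,n_r)) = ζ(n₁,…,n_r)` (Brown's order), i.e. `per (z s.reverse) = multipleZeta s`
  for `s` admissible in the tree's (decreasing) convention. -/
  per_z : ∀ s : List ℕ, IsAdmissible s → per (z s.reverse) = multipleZeta s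
  /-- The weight-`N` piece `H_N ⊆ H_N^{MT⁺}`. -/
  V : ℕ → Submodule ℚ H
  /-- `ζᵐ ∈ H_N` in weight `N` (the weight of `s.reverse` is that of `s`). -/
  z_mem : ∀ s : List ℕ, IsAdmissible s → z s.reverse ∈ V (weight s)
  /-- `H_N` is finite-dimensional … -/
  finiteDimensional : ∀ N, FiniteDimensional ℚ (V N)
  /-- … of dimension `≤ d_N` ((2.23)). -/
  finrank_le : ∀ N, Module.finrank ℚ (V N) ≤ zagierDim N

/-- Motivic data give a Hoffman model in every weight, with lifts `s ↦ z s.reverse`: the linear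
independence field of `HoffmanModel` is now Theorem 7.4 (`LevelData.linearIndependent_hoffman`,
transported along the reversal involution of the Hoffman words of weight `N`) rather than an
assumption. [cite: Brown2012, §7.2] -/
def MotivicData.hoffmanModel (M : MotivicData) (N : ℕ) : HoffmanModel N where
  V := M.V N
  instFiniteDimensional := M.finiteDimensional N
  finrank_le := M.finrank_le N
  lift := fun s => ⟨M.z s.1.reverse, by have h := M.z_mem s.1 s.2.1; rw [s.2.2] at h; exact h⟩
  per := M.per ∘ₗ (M.V N).subtype
  per_lift := fun s => by simp [M.per_z s.1 s.2.1]
  linearIndependent_hoffman := by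
    refine LinearIndependent.of_comp (M.V N).subtype ?_
    have h := (linearIndependent_equiv (hoffmanReverseEquiv N)
      (f := fun w : {w : List ℕ // IsHoffman w ∧ weight w = N} => M.z w.1)).2
      (M.toLevelData.linearIndependent_hoffman N)
    exact h

end Brown2012

/-- **The named fact from Brown's motivic data** (Brown 2012, Theorem 1.1 ⟹ Conjecture 2, the
whole of §7.2 now formal): motivic data `(H, ζᵐ, D, per, H_N)` — i.e. mixed Tate motives over `ℤ`
((2.23)), motivic MZVs with their period map, the level-lowering Lemma 5.5 / Lemma 3.4, and the
matrix congruence of Theorem 6.1 (with Theorem 4.3, Corollary 4.4 (1), Lemma 3.8) — imply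
`hoffmanSpan_eq_mzvSpace`, through Theorem 7.3 (`isUnit_levelMatrix_add`), Theorem 7.4
(`LevelData.linearIndependent_hoffman`) and Corollary 7.5 (`hoffmanSpan_eq_of_hoffmanModel`).
[cite: Brown2012, Theorem 1.1 and §7.2] -/
theorem hoffmanSpan_eq_mzvSpace_of_motivicData (M : Brown2012.MotivicData) :
    hoffmanSpan_eq_mzvSpace :=
  hoffmanSpan_eq_mzvSpace_of_hoffmanModel fun N => M.hoffmanModel N

end Literature.NumberTheory.Transcendental
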